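import Summits.HodgeConjecture.HodgeConjecture.Theorems.F0P3cStCharTSShellWeight       -- ★ (LH1-p03 g2) `vanDijkWeight_eq_of_isUnit_normAbs`, `normAbs_apply_ne_zero`; brings ★ VanDijkWeylSymm (`vanDijkWeight_eq_zero_of_not`), ★ TorusDefs (`vanDijkWeight`)
import Literature.NumberTheory.Automorphic.CMPrincipalSeriesJacquetEvalOne              -- ★ `continuous_torusEntry`
import Literature.NumberTheory.Automorphic.LocalFieldHaarBalls                          -- ★ `LocalFieldHaar.continuous_normAbs`
import HarnessLib

/-!
# F0 · P3c · line LH6 «StCharTS» — «VDW-CORE★» (file 1 of 2): van Dijk's weight `Δ` on the WHOLE diagonal torus — closed form, realness, positivity ⇔ regularity,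
# CONTINUITY [Rogawski1990, §12.7 L. 12.7.2 (proof) p. 193; §4.9 (4.9.4) p. 56; §12.2 p. 173]

Cell `pub/hodgecm-mathlib`, crux H413 = `stmt-HodgeConjecture-24833` (lane `--supports … --as helper`), route HCCMUnconditional; seat F0P3a-p07 (g17), desk F0P3-plan
(g15) DEAL (c1) «VDW-CORE» 2026-09-02T09:04:16Z, integrator LH6-p01 (g3) 09:07:11Z (i) ∕ 09:17:56Z ∕ 09:28:50Z «=».  THEOREMS ONLY (no definition ∕ instance ∕ notation ∕
named fact ∕ `sorry`); ★-only imports.  HONEST LABEL: HC_CM is proved only modulo the 7 printed citations (2 remaining named inputs: hLiu418 = `stmt-HodgeConjecture-24832`,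
h413 = `stmt-HodgeConjecture-24833`) until rung 0 closes; count-neutral (TOR)-road plumbing for the (HCB)∕(L1M) sockets of the (S-𝔇) organ `stub_EllipticPackage` of
`Cruxes/H413/Lines/F0_P3c_StCharTSPaydown.lean` (heads ★ ₇ ∕ ₈ `Theorems/F0P3cStCharTSSaHeadTorus7∕8`, LH6-p01); it closes no organ by itself.  File 2 = `F0P3cStCharTSVanDijkHC`
(the junction `√√‖u‖ = Re Δ(t)` with Harish-Chandra's weight `|D_G|^{1∕2}`).

SETTING.  `v` a finite place of `L⁺` NON-SPLIT in the CM field `L` (one place `w ∣ v`, `hns`), `R = LocalRing L v`, `|·|_w = normAbs (L_w)`; `T = (cmBorelTriple L 3 v).M`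
the diagonal torus of `U(Φ₃)(L⁺_v)`, `dᵢ = torusEntry i t`, `a − 1 = d₀⁻¹d₁ − 1`, `b − 1 = d₀⁻¹d₂ − 1` (the regularity tokens of ★ `vanDijkWeight`).
* §0 one-place bookkeeping: `IsUnit x ↔ x_w ≠ 0`, `|x_w − 1|_w = 0` for a non-unit `x − 1`, `|x_w − 1|_w ≠ 0 ↔ x − 1` a unit; three scalar cast identities.
* §1 **`Δ(t) = |d₀|_w · |a − 1|_w · √|b − 1|_w` for EVERY `t`** (`vanDijkWeight_eq_normAbs`: ★ `vanDijkWeight_eq_of_isUnit_normAbs` on the regular set, ★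
  `vanDijkWeight_eq_zero_of_not` off it where a factor `|· − 1|_w` vanishes); hence `Im Δ = 0`, `((Re Δ : ℝ) : ℂ) = Δ`, `0 ≤ Re Δ`, `Re Δ(t) > 0 ⇔ t regular`, and
  **`Δ` is CONTINUOUS on `T`** (`continuous_vanDijkWeight`; ★ `continuous_torusEntry`, ★ `continuous_normAbs`) — the measurability input of head ₈ (LH6-p01 (g3)).
Print: `Δ(m) = |D_G(m)|` (p. 193), `= max(‖α‖, ‖α‖⁻¹)` off `M_c` (★ `vanDijkWeight_torusChart_of_not_mem`), `= |a − 1|·|b − 1|^{1∕2}` on `M_c`.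

## References
* [Rogawski1990] J. D. Rogawski, *Automorphic Representations of Unitary Groups in Three Variables*, Ann. of Math. Stud. 123 (1990): §4.9 (4.9.4) p. 56; §12.2 p. 173;
  §12.5 p. 182; §12.7 L. 12.7.2 (proof) p. 193.
* [vanDijk1972] G. van Dijk, *Computation of certain induced characters of 𝔭-adic groups*, Math. Ann. 199 (1972), Thm. p. 237.
* [WeilBNT1967] A. Weil, *Basic Number Theory* (1967), Ch. I §2 (the module of a local field).
-/

set_option autoImplicit false
-- the mandated namespace has the single-problem summit's repeated segment (`HodgeConjecture.HodgeConjecture`)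
set_option linter.dupNamespace false

noncomputable section

open NumberField IsDedekindDomain MeasureTheory Topology
open scoped Matrix MatrixGroups NNReal
open Literature.NumberTheory.Rogawski1990 Literature.NumberTheory.Automorphic Literature.NumberTheory.Automorphic.UnitaryGroup
open Literature.NumberTheory.GaloisRepresentations Literature.NumberTheory.GaloisRepresentations.IsNonarchimedeanLocalField

namespace Summit.HodgeConjecture.HodgeConjecture.Cruxes.H413.F0P3cStCharTSVanDijkCore

open F0P3cStCharTSTorusDefs

variable (L : Type) [Field L] [NumberField L] [IsCMField L] (v : HeightOneSpectrum (𝓞 ↥(maximalRealSubfield L)))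

/-! ## §0 One place above a non-split `v`: units of `R = ∏_{w∣v} L_w`; scalar casts -/

/-- At a non-split `v` (one place `w ∣ v`), `x ∈ R = ∏_{w′∣v} L_{w′}` is a unit iff its `w`-component is non-zero. [cite: WeilBNT1967, Ch. I §2] -/
theorem isUnit_iff_apply_ne_zero (w : PlacesOver L v) (hw : IsCMField.complexConj L • w.1 = w.1) (x : LocalRing L v) :
    IsUnit x ↔ x w ≠ 0 := by
  haveI := PlacesOver.subsingleton_of_smul_eq (IsCMField.complexConj L) (IsCMField.complexConj_ne_one L) w hw
  constructor
  · rintro ⟨u, rfl⟩ h0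
    have h1 : ((u : LocalRing L v) * ((u⁻¹ : (LocalRing L v)ˣ) : LocalRing L v)) w = 1 := by rw [Units.mul_inv]; rfl
    rw [Pi.mul_apply, h0, zero_mul] at h1
    exact zero_ne_one h1
  · intro hx
    have hne : ∀ w' : PlacesOver L v, x w' ≠ 0 := fun w' => by
      obtain rfl : w = w' := Subsingleton.elim w w'
      exact hx
    exact isUnit_iff_exists_inv.2 ⟨fun w' => (x w')⁻¹, funext fun w' => mul_inv_cancel₀ (hne w')⟩

/-- Contrapositive reading: a NON-unit of `R` has `w`-component `0` (one place above `v`). [cite: WeilBNT1967, Ch. I §2] -/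
theorem apply_eq_zero_of_not_isUnit (w : PlacesOver L v) (hw : IsCMField.complexConj L • w.1 = w.1) {x : LocalRing L v} (hx : ¬ IsUnit x) :
    x w = 0 := by
  by_contra h
  exact hx ((isUnit_iff_apply_ne_zero L v w hw x).2 h)

/-- … hence `|x_w − 1|_w = 0` whenever `x − 1` is a non-unit (one place above `v`). [cite: WeilBNT1967, Ch. I §2] -/
theorem normAbs_apply_sub_one_eq_zero (w : PlacesOver L v) (hw : IsCMField.complexConj L • w.1 = w.1) {x : LocalRing L v} (hx : ¬ IsUnit (x - 1)) :
    normAbs (w.1.adicCompletion L) (x w - 1) = 0 := by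
  have h0 := apply_eq_zero_of_not_isUnit L v w hw hx
  rw [Pi.sub_apply, Pi.one_apply] at h0
  rw [h0, map_zero]

/-- … and `|x_w − 1|_w ≠ 0` iff `x − 1` is a unit (one place above `v`). [cite: WeilBNT1967, Ch. I §2] -/
theorem normAbs_apply_sub_one_ne_zero_iff (w : PlacesOver L v) (hw : IsCMField.complexConj L • w.1 = w.1) (x : LocalRing L v) :
    normAbs (w.1.adicCompletion L) (x w - 1) ≠ 0 ↔ IsUnit (x - 1) := by
  rw [isUnit_iff_apply_ne_zero L v w hw, Pi.sub_apply, Pi.one_apply, _root_.map_ne_zero]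

/-- Scalar bookkeeping (`ℝ≥0 → ℝ → ℂ` casts): `a · ((b⁻¹ : ℝ≥0))⁻¹ = a · b` (both sides `0` when `b = 0`). [folklore] -/
theorem ofReal_coe_mul_inv_coe_inv (a b : ℝ≥0) : (((a : ℝ) : ℂ)) * ((((b⁻¹ : ℝ≥0) : ℝ) : ℂ))⁻¹ = (((a * b : ℝ≥0) : ℝ) : ℂ) := by
  rw [NNReal.coe_inv, Complex.ofReal_inv, inv_inv, ← Complex.ofReal_mul, ← NNReal.coe_mul]

/-- Scalar bookkeeping: `0 = a · (0 · c)` through the casts. [folklore] -/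
theorem zero_eq_ofReal_coe_mul_zero_mul (a c : ℝ≥0) : (0 : ℂ) = (((a * (0 * c) : ℝ≥0) : ℝ) : ℂ) := by
  rw [zero_mul, mul_zero, NNReal.coe_zero, Complex.ofReal_zero]

/-- Scalar bookkeeping: `0 = a · (b · √0)` through the casts. [folklore] -/
theorem zero_eq_ofReal_coe_mul_mul_sqrt_zero (a b : ℝ≥0) : (0 : ℂ) = (((a * (b * NNReal.sqrt 0) : ℝ≥0) : ℝ) : ℂ) := by
  rw [NNReal.sqrt_zero, mul_zero, mul_zero, NNReal.coe_zero, Complex.ofReal_zero]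

/-- Scalar bookkeeping: for `a ≠ 0`, `0 < a · (b · √c)` iff `b ≠ 0 ∧ c ≠ 0`. [folklore] -/
theorem coe_mul_mul_sqrt_pos_iff {a : ℝ≥0} (ha : a ≠ 0) (b c : ℝ≥0) : 0 < ((a * (b * NNReal.sqrt c) : ℝ≥0) : ℝ) ↔ b ≠ 0 ∧ c ≠ 0 := by
  rw [NNReal.coe_pos, pos_iff_ne_zero, mul_ne_zero_iff, mul_ne_zero_iff]
  exact ⟨fun h => ⟨h.2.1, fun hc => h.2.2 (by rw [hc, NNReal.sqrt_zero])⟩, fun h => ⟨ha, h.1, fun hs => h.2 (NNReal.sqrt_eq_zero.1 hs)⟩⟩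

/-! ## §1 The closed form of `Δ` on all of `T`; realness; positivity ⇔ regularity; continuity -/

section Weight

variable (hns : ∀ w : PlacesOver L v, IsCMField.complexConj L • w.1 = w.1)

set_option maxHeartbeats 400000 in -- the statement carries the (4.9.4) weight tokens three times
/-- **`Δ(t) = |d₀|_w · |a − 1|_w · √|b − 1|_w` FOR EVERY `t ∈ T`** (non-split `v`, the one place `w ∣ v`): ★ `vanDijkWeight_eq_of_isUnit_normAbs` on the regular set
(double inverse removed), ★ `vanDijkWeight_eq_zero_of_not` off it (then `a − 1` or `b − 1` is a non-unit, its `w`-component is `0`, and the right side vanishes too).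
[cite: Rogawski1990, §12.7 L. 12.7.2 (proof) p. 193; §4.9 (4.9.4) p. 56] [cite: vanDijk1972, Thm. p. 237] -/
theorem vanDijkWeight_eq_normAbs (w : PlacesOver L v) (hw : IsCMField.complexConj L • w.1 = w.1) (t : ↥(cmBorelTriple L 3 v).M) :
    vanDijkWeight L v t =
      (((normAbs (w.1.adicCompletion L) ((torusEntry (conjLocal L (IsCMField.complexConj L) v) (cmLocalForm L 3 v) 0 t : LocalRing L v) w) *
          (normAbs (w.1.adicCompletion L)
              ((((torusEntry (conjLocal L (IsCMField.complexConj L) v) (cmLocalForm L 3 v) 0 t)⁻¹ *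
                torusEntry (conjLocal L (IsCMField.complexConj L) v) (cmLocalForm L 3 v) 1 t : (LocalRing L v)ˣ) : LocalRing L v) w - 1) *
            NNReal.sqrt (normAbs (w.1.adicCompletion L)
              ((((torusEntry (conjLocal L (IsCMField.complexConj L) v) (cmLocalForm L 3 v) 0 t)⁻¹ *
                torusEntry (conjLocal L (IsCMField.complexConj L) v) (cmLocalForm L 3 v) 2 t : (LocalRing L v)ˣ) : LocalRing L v) w - 1))) : ℝ≥0) : ℝ) : ℂ) := by
  rcases Classical.em (IsUnit ((((torusEntry (conjLocal L (IsCMField.complexConj L) v) (cmLocalForm L 3 v) 0 t)⁻¹ *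
        torusEntry (conjLocal L (IsCMField.complexConj L) v) (cmLocalForm L 3 v) 1 t : (LocalRing L v)ˣ) : LocalRing L v) - 1) ∧
      IsUnit ((((torusEntry (conjLocal L (IsCMField.complexConj L) v) (cmLocalForm L 3 v) 0 t)⁻¹ *
        torusEntry (conjLocal L (IsCMField.complexConj L) v) (cmLocalForm L 3 v) 2 t : (LocalRing L v)ˣ) : LocalRing L v) - 1)) with h | h
  · rw [F0P3cStCharTSShellWeight.vanDijkWeight_eq_of_isUnit_normAbs L v w hw t h.1 h.2]
    exact ofReal_coe_mul_inv_coe_inv _ _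
  · rw [F0P3cStCharTSVanDijkWeylSymm.vanDijkWeight_eq_zero_of_not L v t h]
    rcases not_and_or.1 h with ha | hb
    · rw [normAbs_apply_sub_one_eq_zero L v w hw ha]
      exact zero_eq_ofReal_coe_mul_zero_mul _ _
    · rw [normAbs_apply_sub_one_eq_zero L v w hw hb]
      exact zero_eq_ofReal_coe_mul_mul_sqrt_zero _ _

include hns in
/-- **`Δ(t)` IS REAL**: `Im Δ(t) = 0`. [cite: Rogawski1990, §12.7 L. 12.7.2 (proof) p. 193] -/
theorem vanDijkWeight_im (t : ↥(cmBorelTriple L 3 v).M) : (vanDijkWeight L v t).im = 0 := by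
  obtain ⟨w⟩ : Nonempty (PlacesOver L v) := inferInstance
  rw [vanDijkWeight_eq_normAbs L v w (hns w) t, Complex.ofReal_im]

include hns in
/-- `((Re Δ(t) : ℝ) : ℂ) = Δ(t)` — the (TOR⁗) integrand's cast `((Δ(ι m)).re : ℂ)` IS `Δ(ι m)`. [cite: Rogawski1990, §12.7 L. 12.7.2 (proof) p. 193] -/
theorem ofReal_vanDijkWeight_re (t : ↥(cmBorelTriple L 3 v).M) : (((vanDijkWeight L v t).re : ℝ) : ℂ) = vanDijkWeight L v t :=
  Complex.ext (by rw [Complex.ofReal_re]) (by rw [Complex.ofReal_im, vanDijkWeight_im L v hns t])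

/-- **`Re Δ(t)` in `|·|_w`-tokens**: `Re Δ(t) = |d₀|_w · |a − 1|_w · √|b − 1|_w`. [cite: Rogawski1990, §12.7 L. 12.7.2 (proof) p. 193; §4.9 (4.9.4) p. 56] -/
theorem vanDijkWeight_re_eq_normAbs (w : PlacesOver L v) (hw : IsCMField.complexConj L • w.1 = w.1) (t : ↥(cmBorelTriple L 3 v).M) :
    (vanDijkWeight L v t).re =
      ((normAbs (w.1.adicCompletion L) ((torusEntry (conjLocal L (IsCMField.complexConj L) v) (cmLocalForm L 3 v) 0 t : LocalRing L v) w) *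
          (normAbs (w.1.adicCompletion L)
              ((((torusEntry (conjLocal L (IsCMField.complexConj L) v) (cmLocalForm L 3 v) 0 t)⁻¹ *
                torusEntry (conjLocal L (IsCMField.complexConj L) v) (cmLocalForm L 3 v) 1 t : (LocalRing L v)ˣ) : LocalRing L v) w - 1) *
            NNReal.sqrt (normAbs (w.1.adicCompletion L)
              ((((torusEntry (conjLocal L (IsCMField.complexConj L) v) (cmLocalForm L 3 v) 0 t)⁻¹ *
                torusEntry (conjLocal L (IsCMField.complexConj L) v) (cmLocalForm L 3 v) 2 t : (LocalRing L v)ˣ) : LocalRing L v) w - 1))) : ℝ≥0) : ℝ) := by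
  rw [vanDijkWeight_eq_normAbs L v w hw t, Complex.ofReal_re]

include hns in
/-- **`0 ≤ Re Δ(t)`**. [cite: Rogawski1990, §12.7 L. 12.7.2 (proof) p. 193] -/
theorem vanDijkWeight_re_nonneg (t : ↥(cmBorelTriple L 3 v).M) : 0 ≤ (vanDijkWeight L v t).re := by
  obtain ⟨w⟩ : Nonempty (PlacesOver L v) := inferInstance
  rw [vanDijkWeight_re_eq_normAbs L v w (hns w) t]
  exact NNReal.coe_nonneg _

include hns in
/-- **`Re Δ(t) > 0` IFF `t` IS REGULAR** in the sense of ★ `vanDijkWeight` (`a − 1`, `b − 1` units): `|d₀|_w ≠ 0`, and `|x_w − 1|_w ≠ 0 ⟺ x − 1` is a unit (one place).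
So `Δ` vanishes EXACTLY on the non-regular part of `T`. [cite: Rogawski1990, §12.7 L. 12.7.2 (proof) p. 193; §12.5 p. 182] -/
theorem vanDijkWeight_re_pos_iff (t : ↥(cmBorelTriple L 3 v).M) :
    0 < (vanDijkWeight L v t).re ↔
      IsUnit ((((torusEntry (conjLocal L (IsCMField.complexConj L) v) (cmLocalForm L 3 v) 0 t)⁻¹ *
          torusEntry (conjLocal L (IsCMField.complexConj L) v) (cmLocalForm L 3 v) 1 t : (LocalRing L v)ˣ) : LocalRing L v) - 1) ∧
        IsUnit ((((torusEntry (conjLocal L (IsCMField.complexConj L) v) (cmLocalForm L 3 v) 0 t)⁻¹ *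
          torusEntry (conjLocal L (IsCMField.complexConj L) v) (cmLocalForm L 3 v) 2 t : (LocalRing L v)ˣ) : LocalRing L v) - 1) := by
  obtain ⟨w⟩ : Nonempty (PlacesOver L v) := inferInstance
  rw [vanDijkWeight_re_eq_normAbs L v w (hns w) t, coe_mul_mul_sqrt_pos_iff (F0P3cStCharTSShellWeight.normAbs_apply_ne_zero L v w
    (torusEntry (conjLocal L (IsCMField.complexConj L) v) (cmLocalForm L 3 v) 0 t))]
  exact Iff.and (normAbs_apply_sub_one_ne_zero_iff L v w (hns w) _) (normAbs_apply_sub_one_ne_zero_iff L v w (hns w) _)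

include hns in
/-- **`Δ` IS CONTINUOUS ON `T`** (closed form ∘ continuous coordinates ★ `continuous_torusEntry`, ★ `continuous_normAbs`) — the measurability input of head ₈.
[cite: Rogawski1990, §12.7 L. 12.7.2 (proof) p. 193; §4.9 (4.9.4) p. 56] -/
theorem continuous_vanDijkWeight : Continuous (vanDijkWeight L v) := by
  obtain ⟨w⟩ : Nonempty (PlacesOver L v) := inferInstance
  have hfun : vanDijkWeight L v = fun t =>
      (((normAbs (w.1.adicCompletion L) ((torusEntry (conjLocal L (IsCMField.complexConj L) v) (cmLocalForm L 3 v) 0 t : LocalRing L v) w) *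
          (normAbs (w.1.adicCompletion L)
              ((((torusEntry (conjLocal L (IsCMField.complexConj L) v) (cmLocalForm L 3 v) 0 t)⁻¹ *
                torusEntry (conjLocal L (IsCMField.complexConj L) v) (cmLocalForm L 3 v) 1 t : (LocalRing L v)ˣ) : LocalRing L v) w - 1) *
            NNReal.sqrt (normAbs (w.1.adicCompletion L)
              ((((torusEntry (conjLocal L (IsCMField.complexConj L) v) (cmLocalForm L 3 v) 0 t)⁻¹ *
                torusEntry (conjLocal L (IsCMField.complexConj L) v) (cmLocalForm L 3 v) 2 t : (LocalRing L v)ˣ) : LocalRing L v) w - 1))) : ℝ≥0) : ℝ) : ℂ) :=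
    funext fun t => vanDijkWeight_eq_normAbs L v w (hns w) t
  rw [hfun]
  have hev : Continuous fun x : LocalRing L v => x w := continuous_apply w
  have hE : ∀ i : Fin 3, Continuous fun t : ↥(cmBorelTriple L 3 v).M =>
      ((torusEntry (conjLocal L (IsCMField.complexConj L) v) (cmLocalForm L 3 v) i t : (LocalRing L v)ˣ) : LocalRing L v) w := fun i =>
    hev.comp (Units.continuous_val.comp (continuous_torusEntry (conjLocal L (IsCMField.complexConj L) v) (cmLocalForm L 3 v) i))
  have hQ : ∀ i : Fin 3, Continuous fun t : ↥(cmBorelTriple L 3 v).M =>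
      (((torusEntry (conjLocal L (IsCMField.complexConj L) v) (cmLocalForm L 3 v) 0 t)⁻¹ *
        torusEntry (conjLocal L (IsCMField.complexConj L) v) (cmLocalForm L 3 v) i t : (LocalRing L v)ˣ) : LocalRing L v) w - 1 := fun i =>
    (hev.comp (Units.continuous_val.comp (((continuous_torusEntry (conjLocal L (IsCMField.complexConj L) v) (cmLocalForm L 3 v) 0).inv).mul
      (continuous_torusEntry (conjLocal L (IsCMField.complexConj L) v) (cmLocalForm L 3 v) i)))).sub continuous_const
  have hN : Continuous (normAbs (w.1.adicCompletion L)) := LocalFieldHaar.continuous_normAbs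
  exact Complex.continuous_ofReal.comp (NNReal.continuous_coe.comp
    ((hN.comp (hE 0)).mul ((hN.comp (hQ 1)).mul (NNReal.continuous_sqrt.comp (hN.comp (hQ 2))))))

include hns in
/-- `Δ` is (Borel) measurable on `T`. [cite: Rogawski1990, §12.7 L. 12.7.2 (proof) p. 193] -/
theorem measurable_vanDijkWeight [MeasurableSpace ↥(cmBorelTriple L 3 v).M] [BorelSpace ↥(cmBorelTriple L 3 v).M] : Measurable (vanDijkWeight L v) :=
  (continuous_vanDijkWeight L v hns).measurable

end Weight

end Summit.HodgeConjecture.HodgeConjecture.Cruxes.H413.F0P3cStCharTSVanDijkCore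

end
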